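import Mathlib
import HarnessLib
import Summits.ValiantsHypothesis.ValiantsHypothesis.Theses.MonotoneRestoration
import Literature.Computability.AlgebraicComplexity.ArithCircuit
import Literature.Computability.AlgebraicComplexity.ArithCircuitProofs
import Literature.Computability.AlgebraicComplexity.MonotoneStructure
import Literature.Computability.AlgebraicComplexity.PermanentIrreducible
import Literature.ModelTheory.FiniteModelTheory.CkEquiv
import Summits.ValiantsHypothesis.ValiantsHypothesis.Theorems.MonotoneRestorationMonotoneRestorationQPCosetCount
import Summits.ValiantsHypothesis.ValiantsHypothesis.Theorems.MonotoneRestorationMonotoneRestorationQPSymmetricLB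
import Summits.ValiantsHypothesis.ValiantsHypothesis.Theorems.MonotoneRestorationMonotoneRestorationQPSupportSymmetrisation
import Summits.ValiantsHypothesis.ValiantsHypothesis.Theorems.MonotoneRestorationMonotoneRestorationQPSparseRegime
import Summits.ValiantsHypothesis.ValiantsHypothesis.Theorems.MonotoneRestorationMonotoneRestorationQPBeta
import Literature.Computability.AlgebraicComplexity.SymmetricArithCircuit
import Literature.Computability.AlgebraicComplexity.DawarWilsenach2025Proofs
import Literature.GroupTheory.PermutationGroups.SmallIndexSubgroups
import Summits.ValiantsHypothesis.ValiantsHypothesis.Theorems.MonotoneRestorationQP.Negative.LoadBearing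
import Summits.ValiantsHypothesis.ValiantsHypothesis.Theorems.MonotoneRestorationMonotoneRestorationQPPermSupportCount
import Summits.ValiantsHypothesis.ValiantsHypothesis.Theorems.MonotoneRestorationMonotoneRestorationQPGateSupport

/-! TTRL-lite variant V21335 of stmt-ValiantsHypothesis-15886 -/

-- `Summit.ValiantsHypothesis.ValiantsHypothesis.…` is the tree's mandated single-conjunct layout
-- (Sub = Summit), so the duplicated namespace component is intended.
set_option linter.dupNamespace false

namespace Summit.ValiantsHypothesis.ValiantsHypothesis.Theorems

open Summit.ValiantsHypothesis.ValiantsHypothesis.Theses.MonotoneRestoration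
open Literature.Computability.AlgebraicComplexity

/-- **TTRL-lite variant V21335** (`lemma_proposal`, value-level support theorem) of
`stub_symmetricMonotone_choose_le_card` (crux item `stmt-ValiantsHypothesis-15886`): in a
`Sym_n`-symmetric labelled arithmetic circuit over `ℝ≥0` on the `n × n` matrix of variables with
fewer than `C(n, k)` gates (`n > 8`, `1 ≤ k`, `4k ≤ n`), every gate `g` has a set `X` of fewer than
`k` indices such that the polynomial computed at `g` is invariant under the diagonal renaming
`x_{ij} ↦ x_{ρ i, ρ j}` along every EVEN permutation `ρ` fixing `X` pointwise — the form (`hinv`)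
the descent of `stub_symmetricMonotone_choose_le_card` consumes. Proof: G1 `stub_gateSupport`
gives such an `X` with every even `ρ` fixing `X` extending to an automorphism `π` with `π g = g`,
and automorphisms act on gate values by renaming (`IsAutomorphismExtending.eval_apply`).
[cite: DawarWilsenach2025, §6 (support theorem) and §3.2 (after Def. 3.7); DixonMortimer1996, Thm 5.2B] -/
theorem stub_symmetricMonotone_choose_le_card_var21335 : ∀ (n : ℕ) (G : Type) [Fintype G] (C : LabelledArithCircuit NNReal (Fin n × Fin n) Unit G) (hC : C.IsSymmetric (Equiv.Perm (Fin n))) (k : ℕ) (hn : 8 < n) (hk : 1 ≤ k) (h4k : 4 * k ≤ n) (hcard : Fintype.card G < n.choose k) (g : G), ∃ X : Finset (Fin n), X.card < k ∧ ∀ ρ : Equiv.Perm (Fin n), (∀ x ∈ X, ρ x = x) → Equiv.Perm.sign ρ = 1 → MvPolynomial.rename (fun p : Fin n × Fin n => (ρ p.1, ρ p.2)) (C.eval g) = C.eval g := by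
  intro n G _ C hC k hn hk h4k hcard g
  obtain ⟨X, hXk, hX⟩ := stub_gateSupport C hC hn hk h4k hcard g
  refine ⟨X, hXk, fun ρ hρ hsign => ?_⟩
  obtain ⟨π, hπ, hπg⟩ := hX ρ hρ hsign
  have h := hπ.eval_apply g
  rw [hπg] at h
  exact h.symm

end Summit.ValiantsHypothesis.ValiantsHypothesis.Theorems
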